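import Summits.KontsevichZagierPeriods.KontsevichZagierPeriods.Theorems.XMapPeriodTransfer.Negative.LemniscateReps

/-!
# `XMapPeriodTransfer`: the transfer constant is neither `1/|c|` nor `deg R/|c|` (tightness of the bookkeeping)

Negative knowledge for the crux `IsogenyCertificates.XMapPeriodTransfer`
(stmt-KontsevichZagierPeriods-10665; refuter, cdisprove). The proof plan transfers `[{P>0}, a/√P]`
along the x-map `R = f/g` of a datum `(f, g, c)` to `Σ_comp m_comp · [comp′, (a/|c|)/√P′]` with the
REAL-FIBRE MULTIPLICITIES `m₀, m₁` (constant per component of `{P′>0}`, possibly `0`). Two natural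
shortcuts are FALSE, refuted by the lemniscate 2-isogeny `y² = x³ − x → y² = x³ + 4x`
(`(f,g,c) = (X²−1, X, 1)`, real kernel point, `m₀ = 2`) together with its dual
(`(X²+4, 4X, 2)`, image misses the egg: `m₀ = 2`, `m₁ = 0`):

* `not_naiveMultiplier`: "`[{P>0}, a/√P] ~ [{P′>0}, (a/|c|)/√P′]`" would give `Ω(x³−x) = Ω(x³+4x)`
  and `Ω(x³+4x) = Ω(x³−x)/2`;
* `not_naiveDegree`: "`[{P>0}, a/√P] ~ [{P′>0}, (a·deg R/|c|)/√P′]`" is right for the lemniscate datum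
  (`Ω(x³−x) = 2Ω(x³+4x)`, the route's calibration) but for the dual gives `Ω(x³+4x) = Ω(x³−x)`;
either way `Ω(x³−x) = 0`, contradicting `period_pos`. Only soundness of the calculus
(`KZ.Equivalent.value_eq_holds`) and `Ω > 0` are used — no period is computed.
Companion work file: `Cruxes/XMapPeriodTransfer/Disproof.lean`.
-/

noncomputable section

namespace Summit.KontsevichZagierPeriods.IsogenyCertificates.XMapPeriodTransferValue

open Polynomial Set MeasureTheory
open Literature.NumberTheory.Transcendental
open Summit.KontsevichZagierPeriods.KontsevichZagierPeriods.Theses.IsogenyCertificates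

/-! ### Two NAIVE transfer constants are refuted by the lemniscate pair -/

/-- **The transfer constant is not `1/|c|`.** Natural strengthening "an x-map datum `(f,g,c)`
transfers `[{P>0}, a/√P]` to `[{P′>0}, (a/|c|)/√P′]`" (forgetting the real-fibre multiplicity) is
FALSE: the lemniscate datum (`c = 1`) would give `Ω(x³−x) = Ω(x³+4x)` and its dual (`c = 2`) would
give `Ω(x³+4x) = Ω(x³−x)/2`, whence `Ω(x³−x) = 0`; but `Ω > 0`. (Truth: `Ω(x³−x) = 2·Ω(x³+4x)`,
multiplicity `m₀ = 2`.) -/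
theorem not_naiveMultiplier : ¬ (∀ (A B A' B' : ℤ), 4 * A ^ 3 + 27 * B ^ 2 ≠ 0 → 4 * A' ^ 3 + 27 * B' ^ 2 ≠ 0 →
    ∀ (f g : ℚ[X]) (c : ℚ), derivative f * g - f * derivative g ≠ 0 →
      C (c ^ 2) * g * (f ^ 3 + C (A' : ℚ) * f * g ^ 2 + C (B' : ℚ) * g ^ 3) =
        (X ^ 3 + C (A : ℚ) * X + C (B : ℚ)) * (derivative f * g - f * derivative g) ^ 2 →
    ∀ (a : ℚ), 0 < a → ∀ (r r' : KZ.IntegralRep 1),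
      r.domain = {x | 0 < x 0 ^ 3 + (A : ℝ) * x 0 + (B : ℝ)} →
      EqOn r.integrand (fun x => (a : ℝ) / Real.sqrt (x 0 ^ 3 + (A : ℝ) * x 0 + (B : ℝ))) r.domain →
      r'.domain = {x | 0 < x 0 ^ 3 + (A' : ℝ) * x 0 + (B' : ℝ)} →
      EqOn r'.integrand (fun x => ((a / |c| : ℚ) : ℝ) / Real.sqrt (x 0 ^ 3 + (A' : ℝ) * x 0 + (B' : ℝ))) r'.domain →
      KZ.Equivalent r r') := by
  intro h
  obtain ⟨rL, hdL, hiL⟩ := exists_rep_lemniscate 1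
  obtain ⟨r4, hd4, hi4⟩ := exists_rep_four 1
  obtain ⟨rL', hdL', hiL'⟩ := exists_rep_lemniscate (1 / 2)
  -- datum 1: lemniscate, c = 1
  have hW1 : derivative (X ^ 2 - 1 : ℚ[X]) * X - (X ^ 2 - 1) * derivative X ≠ 0 := by
    have hW : derivative (X ^ 2 - 1 : ℚ[X]) * X - (X ^ 2 - 1) * derivative X = X ^ 2 + 1 := by
      simp only [derivative_sub, derivative_X_pow, derivative_one, derivative_X, Nat.cast_ofNat,
        map_ofNat, Nat.add_one_sub_one, pow_one]
      ring
    rw [hW]; intro h0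
    have := congrArg (fun p : ℚ[X] => p.eval 0) h0
    norm_num at this
  have hI1 : C ((1 : ℚ) ^ 2) * (X : ℚ[X]) * ((X ^ 2 - 1) ^ 3 + C ((4 : ℤ) : ℚ) * (X ^ 2 - 1) * X ^ 2 +
        C ((0 : ℤ) : ℚ) * X ^ 3) =
      (X ^ 3 + C ((-1 : ℤ) : ℚ) * X + C ((0 : ℤ) : ℚ)) *
        (derivative (X ^ 2 - 1 : ℚ[X]) * X - (X ^ 2 - 1) * derivative X) ^ 2 := by
    refine Polynomial.funext fun x => ?_
    simp only [derivative_sub, derivative_X_pow, derivative_one, derivative_X, Nat.cast_ofNat,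
      map_ofNat, Nat.add_one_sub_one, pow_one]
    simp; ring
  -- datum 2: the dual, c = 2
  have hW2 : derivative (X ^ 2 + 4 : ℚ[X]) * (4 * X) - (X ^ 2 + 4) * derivative (4 * X) ≠ 0 := by
    have hW : derivative (X ^ 2 + 4 : ℚ[X]) * (4 * X) - (X ^ 2 + 4) * derivative (4 * X) =
        4 * X ^ 2 - 16 := by
      simp only [derivative_add, derivative_X_pow, derivative_mul, derivative_X, Nat.cast_ofNat,
        map_ofNat, derivative_ofNat, Nat.add_one_sub_one, pow_one, zero_mul, zero_add, add_zero,
        mul_one]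
      ring
    rw [hW]; intro h0
    have := congrArg (fun p : ℚ[X] => p.eval 0) h0
    norm_num at this
  have hI2 : C ((2 : ℚ) ^ 2) * (4 * X : ℚ[X]) * ((X ^ 2 + 4) ^ 3 + C ((-1 : ℤ) : ℚ) * (X ^ 2 + 4) * (4 * X) ^ 2 +
        C ((0 : ℤ) : ℚ) * (4 * X) ^ 3) =
      (X ^ 3 + C ((4 : ℤ) : ℚ) * X + C ((0 : ℤ) : ℚ)) *
        (derivative (X ^ 2 + 4 : ℚ[X]) * (4 * X) - (X ^ 2 + 4) * derivative (4 * X)) ^ 2 := by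
    refine Polynomial.funext fun x => ?_
    simp only [derivative_add, derivative_X_pow, derivative_mul, derivative_X, Nat.cast_ofNat,
      map_ofNat, derivative_ofNat, Nat.add_one_sub_one, pow_one, zero_mul, zero_add, add_zero,
      mul_one]
    simp; ring
  have e1 : KZ.Equivalent rL r4 :=
    h (-1) 0 4 0 (by norm_num) (by norm_num) (X ^ 2 - 1) X 1 hW1 hI1 1 one_pos rL r4 hdL
      (fun x _ => by rw [hiL]) hd4 (fun x _ => by rw [hi4]; norm_num)
  have e2 : KZ.Equivalent r4 rL' :=
    h 4 0 (-1) 0 (by norm_num) (by norm_num) (X ^ 2 + 4) (4 * X) 2 hW2 hI2 1 one_pos r4 rL' hd4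
      (fun x _ => by rw [hi4]) hdL' (fun x _ => by rw [hiL']; norm_num)
  have v1 := KZ.Equivalent.value_eq_holds e1
  have v2 := KZ.Equivalent.value_eq_holds e2
  rw [value_eq (A := -1) (B := 0) (a := 1) rL hdL (fun x _ => by rw [hiL]),
    value_eq (A := 4) (B := 0) (a := 1) r4 hd4 (fun x _ => by rw [hi4])] at v1
  rw [value_eq (A := 4) (B := 0) (a := 1) r4 hd4 (fun x _ => by rw [hi4]),
    value_eq (A := -1) (B := 0) (a := 1 / 2) rL' hdL' (fun x _ => by rw [hiL'])] at v2
  have hΩ := period_pos (A := -1) (B := 0)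
    (integrableOn_of_rep (a := 1) rL hdL (fun x _ => by rw [hiL]) one_ne_zero)
  push_cast at v1 v2
  linarith

/-- **The transfer constant is not `deg R/|c|` either.** Natural strengthening "a datum of degree
`d = max(deg f, deg g)` transfers `[{P>0}, a/√P]` to `[{P′>0}, (a·d/|c|)/√P′]`" (every fibre
full) is FALSE: true for the lemniscate datum (`d = 2`, `c = 1`, giving the correct
`Ω(x³−x) = 2Ω(x³+4x)`) but for its dual (`d = 2`, `c = 2`) it gives `Ω(x³+4x) = Ω(x³−x)`, whence
`Ω(x³−x) = 0`. So the real-fibre multiplicity `m₀ + m₁` (here `2` resp. `2 + 0` — NOT `d` on each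
component) is essential bookkeeping. -/
theorem not_naiveDegree : ¬ (∀ (A B A' B' : ℤ), 4 * A ^ 3 + 27 * B ^ 2 ≠ 0 → 4 * A' ^ 3 + 27 * B' ^ 2 ≠ 0 →
    ∀ (f g : ℚ[X]) (c : ℚ), derivative f * g - f * derivative g ≠ 0 →
      C (c ^ 2) * g * (f ^ 3 + C (A' : ℚ) * f * g ^ 2 + C (B' : ℚ) * g ^ 3) =
        (X ^ 3 + C (A : ℚ) * X + C (B : ℚ)) * (derivative f * g - f * derivative g) ^ 2 →
    ∀ (a : ℚ), 0 < a → ∀ (r r' : KZ.IntegralRep 1),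
      r.domain = {x | 0 < x 0 ^ 3 + (A : ℝ) * x 0 + (B : ℝ)} →
      EqOn r.integrand (fun x => (a : ℝ) / Real.sqrt (x 0 ^ 3 + (A : ℝ) * x 0 + (B : ℝ))) r.domain →
      r'.domain = {x | 0 < x 0 ^ 3 + (A' : ℝ) * x 0 + (B' : ℝ)} →
      EqOn r'.integrand (fun x => ((a * (max f.natDegree g.natDegree : ℕ) / |c| : ℚ) : ℝ) /
        Real.sqrt (x 0 ^ 3 + (A' : ℝ) * x 0 + (B' : ℝ))) r'.domain →
      KZ.Equivalent r r') := by
  intro h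
  obtain ⟨rL, hdL, hiL⟩ := exists_rep_lemniscate 1
  obtain ⟨r4, hd4, hi4⟩ := exists_rep_four 1
  obtain ⟨r4', hd4', hi4'⟩ := exists_rep_four 2
  have hW1e : derivative (X ^ 2 - 1 : ℚ[X]) * X - (X ^ 2 - 1) * derivative X = X ^ 2 + 1 := by
    simp only [derivative_sub, derivative_X_pow, derivative_one, derivative_X, Nat.cast_ofNat,
      map_ofNat, Nat.add_one_sub_one, pow_one]
    ring
  have hW1 : derivative (X ^ 2 - 1 : ℚ[X]) * X - (X ^ 2 - 1) * derivative X ≠ 0 := by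
    rw [hW1e]; intro h0
    have := congrArg (fun p : ℚ[X] => p.eval 0) h0
    norm_num at this
  have hI1 : C ((1 : ℚ) ^ 2) * (X : ℚ[X]) * ((X ^ 2 - 1) ^ 3 + C ((4 : ℤ) : ℚ) * (X ^ 2 - 1) * X ^ 2 +
        C ((0 : ℤ) : ℚ) * X ^ 3) =
      (X ^ 3 + C ((-1 : ℤ) : ℚ) * X + C ((0 : ℤ) : ℚ)) *
        (derivative (X ^ 2 - 1 : ℚ[X]) * X - (X ^ 2 - 1) * derivative X) ^ 2 := by
    refine Polynomial.funext fun x => ?_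
    rw [hW1e]; simp; ring
  have hW2e : derivative (X ^ 2 + 4 : ℚ[X]) * (4 * X) - (X ^ 2 + 4) * derivative (4 * X) =
      4 * X ^ 2 - 16 := by
    simp only [derivative_add, derivative_X_pow, derivative_mul, derivative_X, Nat.cast_ofNat,
      map_ofNat, derivative_ofNat, Nat.add_one_sub_one, pow_one, zero_mul, zero_add, add_zero,
      mul_one]
    ring
  have hW2 : derivative (X ^ 2 + 4 : ℚ[X]) * (4 * X) - (X ^ 2 + 4) * derivative (4 * X) ≠ 0 := by
    rw [hW2e]; intro h0
    have := congrArg (fun p : ℚ[X] => p.eval 0) h0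
    norm_num at this
  have hI2 : C ((2 : ℚ) ^ 2) * (4 * X : ℚ[X]) * ((X ^ 2 + 4) ^ 3 + C ((-1 : ℤ) : ℚ) * (X ^ 2 + 4) * (4 * X) ^ 2 +
        C ((0 : ℤ) : ℚ) * (4 * X) ^ 3) =
      (X ^ 3 + C ((4 : ℤ) : ℚ) * X + C ((0 : ℤ) : ℚ)) *
        (derivative (X ^ 2 + 4 : ℚ[X]) * (4 * X) - (X ^ 2 + 4) * derivative (4 * X)) ^ 2 := by
    refine Polynomial.funext fun x => ?_
    rw [hW2e]; simp; ring
  -- degrees: both data have `max (deg f) (deg g) = 2`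
  have hd1 : max (X ^ 2 - 1 : ℚ[X]).natDegree (X : ℚ[X]).natDegree = 2 := by
    rw [natDegree_X, natDegree_sub_eq_left_of_natDegree_lt] <;> simp
  have hd2 : max (X ^ 2 + 4 : ℚ[X]).natDegree (4 * X : ℚ[X]).natDegree = 2 := by
    have h1 : (X ^ 2 + 4 : ℚ[X]).natDegree = 2 := by
      rw [natDegree_add_eq_left_of_natDegree_lt] <;> simp
    have h2 : (4 * X : ℚ[X]).natDegree = 1 := by
      rw [show (4 : ℚ[X]) = C 4 by simp [map_ofNat], natDegree_C_mul_X 4 (by norm_num)]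
    rw [h1, h2]; norm_num
  have e1 : KZ.Equivalent rL r4' :=
    h (-1) 0 4 0 (by norm_num) (by norm_num) (X ^ 2 - 1) X 1 hW1 hI1 1 one_pos rL r4' hdL
      (fun x _ => by rw [hiL]) hd4' (fun x _ => by rw [hi4', hd1]; norm_num)
  have e2 : KZ.Equivalent r4 rL :=
    h 4 0 (-1) 0 (by norm_num) (by norm_num) (X ^ 2 + 4) (4 * X) 2 hW2 hI2 1 one_pos r4 rL hd4
      (fun x _ => by rw [hi4]) hdL (fun x _ => by rw [hiL, hd2]; norm_num)
  have v1 := KZ.Equivalent.value_eq_holds e1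
  have v2 := KZ.Equivalent.value_eq_holds e2
  rw [value_eq (A := -1) (B := 0) (a := 1) rL hdL (fun x _ => by rw [hiL]),
    value_eq (A := 4) (B := 0) (a := 2) r4' hd4' (fun x _ => by rw [hi4'])] at v1
  rw [value_eq (A := 4) (B := 0) (a := 1) r4 hd4 (fun x _ => by rw [hi4]),
    value_eq (A := -1) (B := 0) (a := 1) rL hdL (fun x _ => by rw [hiL])] at v2
  have hΩ := period_pos (A := -1) (B := 0)
    (integrableOn_of_rep (a := 1) rL hdL (fun x _ => by rw [hiL]) one_ne_zero)
  push_cast at v1 v2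
  linarith

end Summit.KontsevichZagierPeriods.IsogenyCertificates.XMapPeriodTransferValue
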